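import Literature.NumberTheory.Automorphic.ShellSmoothingGL2
import Literature.NumberTheory.Automorphic.ShellProjectorBessel
import HarnessLib

/-!
# The conjugate shell projector: `S_{Re} - i S_{Im} = Ē (S_θ f)` and Bessel over the shells for `χ̄_v`

Topic `NumberTheory/Automorphic`; namespace `Literature.NumberTheory.Automorphic`. Companion of
`ShellSmoothingGL2` / `ShellProjectorBessel` (theorems only) for the `n ≤ 2` case of the named fact
`JacquetShalika1981_partialPairL_pole_of_eq_conj`. The real and imaginary parts of the shell
convolution are recovered from the twisted averages for the shell character `χ_v` AND its conjugate
`χ̄_v`: `2 S_{Re(e_J⋆θ)} f = E (S_θ f) + Ē (S_θ f)`, `2i S_{Im(e_J⋆θ)} f = E (S_θ f) - Ē (S_θ f)` with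
`Ē` the twisted average for `χ̄_v` (`coe_smoothedVector_shellRe_sub_shellIm`). This file proves that
`(J, R ∘ ι_v, χ̄_v)` is again a twist datum (`isTwistData_shell_conj`), the conjugate identity, the
norm bounds `‖S_{Re}‖², ‖S_{Im}‖² ≤ (‖E w‖² + ‖Ē w‖²)/2`, and Bessel's inequality over the torus shells
for `Ē` (`sum_norm_sq_twistedAverage_torus_le_conj`, same proof as for `E` with conjugate
eigenvalues). No named facts.

## References

* D. Bump, *Automorphic Forms and Representations*, CUP (1997), §4.4 [Bump1997].
* H. Jacquet, J. A. Shalika, *On Euler products and the classification of automorphic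
  representations I*, Amer. J. Math. 103 (1981), §5 [JacquetShalikaAJM1981].
-/

noncomputable section

open scoped MatrixGroups ComplexConjugate InnerProductSpace Classical
open WithZero NumberField IsDedekindDomain MeasureTheory Topology

namespace Literature.NumberTheory.Automorphic

open ShellGL2

section Place

variable {K : Type} [Field K] [NumberField K] {v : HeightOneSpectrum (𝓞 K)}
variable [MeasurableSpace (GL (Fin 2) (v.adicCompletion K))] [BorelSpace (GL (Fin 2) (v.adicCompletion K))]
variable {μ : Measure (AdelicGroupData.gl 2 K).automorphicQuotient} [(AdelicGroupData.gl 2 K).IsAutomorphicMeasure μ]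

local notation "𝐧ᵥ" => (Matrix.GeneralLinearGroup.upperRightHom : AddChar (v.adicCompletion K) (GL (Fin 2) (v.adicCompletion K)))
local notation "𝐚ᵥ" t:max => glDiagonal 2 (v.adicCompletion K) ![t, 1]
local notation "πᵥ" => localRightRegular K v μ
/-- The conjugate shell character `χ̄_v`. -/
local notation "χ̄ᵥ" => (fun j : GL (Fin 2) (v.adicCompletion K) => conj (shellChar K v j))

variable {r c : ℤ} (hc : 1 ≤ c)
  (hψ : ∀ x : v.adicCompletion K, Valued.v x ≤ exp (r - c) → (adeleAddChar K).adicComponent v x = 1)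

variable (K v μ) in
include hψ in
omit [MeasurableSpace (GL (Fin 2) (v.adicCompletion K))] [BorelSpace (GL (Fin 2) (v.adicCompletion K))] in
/-- **The conjugate shell twist datum** `(J_{r,c}, R ∘ ι_v, χ̄_v)`. [cite: Bump1997, §4.4] -/
theorem isTwistData_shell_conj :
    IsTwistData (shellSubgroup (F := v.adicCompletion K) r c hc) (localRightRegular K v μ) χ̄ᵥ := by
  have h := isTwistData_shell K v μ hc hψ
  exact { norm_rep := h.norm_rep
          continuous_rep := h.continuous_rep
          mul_char := fun j hj j' hj' => by simp only [h.mul_char j hj j' hj', map_mul]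
          norm_char := fun j hj => by simp only [RCLike.norm_conj, h.norm_char j hj]
          continuous_char := Complex.continuous_conj.comp h.continuous_char }

/-- The conjugated conjugate projector `Ē_a x = π(a)⁻¹ Ē (π(a) x)`. -/
local notation "Ēₐ" a:max x:max => πᵥ a⁻¹ (twistedAverage (shellSubgroup (F := v.adicCompletion K) r c hc)
  (isCompact_shellSubgroup K v hc) πᵥ χ̄ᵥ (πᵥ a x))

include hψ in
/-- `π(n(t⁻¹ z)) Ē_{a(t)} x = ψ̄_v(z) · Ē_{a(t)} x` for `|z| ≤ e^{r}`. [cite: Bump1997, §4.4] -/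
theorem rep_upper_conjProjector_conj (t : (v.adicCompletion K)ˣ) {z : v.adicCompletion K} (hz : Valued.v z ≤ exp r)
    (x : (AdelicGroupData.gl 2 K).L2 μ) :
    πᵥ (𝐧ᵥ (((t⁻¹ : (v.adicCompletion K)ˣ) : v.adicCompletion K) * z)) (Ēₐ (𝐚ᵥ t) x) =
      conj ((((adeleAddChar K).adicComponent v) z : Circle) : ℂ) • Ēₐ (𝐚ᵥ t) x := by
  have hT := isTwistData_shell_conj K v μ hc hψ
  have h := hT.rep_conj_smul_of_twistedAverage (hJ := isCompact_shellSubgroup K v hc) (𝐚ᵥ t) (n_mem_shellSubgroup (hc := hc) hz) x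
  rw [aInv_mul_n_mul_a] at h
  rw [h, shellChar_apply]
  rfl

include hψ in
/-- Orthogonality of the conjugated conjugate projectors along the torus. [cite: JacquetShalikaAJM1981, §5] -/
theorem inner_conjProjector_conj_eq_zero {ϖ : (v.adicCompletion K)ˣ} (hϖ : Valued.v (ϖ : v.adicCompletion K) = exp (-1 : ℤ))
    {x₀ : v.adicCompletion K} (hx₀ : Valued.v x₀ ≤ exp r) (hx₀ψ : (adeleAddChar K).adicComponent v x₀ ≠ 1)
    (x : (AdelicGroupData.gl 2 K).L2 μ) {m m' : ℤ} (hmm' : m ≠ m') :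
    ⟪Ēₐ (𝐚ᵥ (ϖ ^ m)) x, Ēₐ (𝐚ᵥ (ϖ ^ m')) x⟫_ℂ = 0 := by
  have hT := isTwistData_shell_conj K v μ hc hψ
  wlog hlt : m < m' generalizing m m'
  · have h' := this hmm'.symm (lt_of_le_of_ne (not_lt.1 hlt) hmm'.symm)
    rw [← inner_conj_symm, h', map_zero]
  set k : ℤ := m' - m with hk
  have hk1 : 1 ≤ k := by omega
  have hϖk : Valued.v (((ϖ ^ k : (v.adicCompletion K)ˣ) : v.adicCompletion K)) < 1 := by
    rw [valued_zpow_uniformizer hϖ, ← exp_zero, exp_lt_exp]; omega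
  have hu : Valued.v (1 - ((ϖ ^ k : (v.adicCompletion K)ˣ) : v.adicCompletion K)) = 1 := Valuation.map_one_sub_of_lt _ hϖk
  have hu0 : (1 - ((ϖ ^ k : (v.adicCompletion K)ˣ) : v.adicCompletion K)) ≠ 0 := fun h0 => by
    rw [h0, Valuation.map_zero] at hu; exact zero_ne_one hu
  set zs : v.adicCompletion K := x₀ * (1 - ((ϖ ^ k : (v.adicCompletion K)ˣ) : v.adicCompletion K))⁻¹ with hzs
  have hzs_v : Valued.v zs ≤ exp r := by
    rw [hzs, map_mul, map_inv₀, hu, inv_one, mul_one]; exact hx₀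
  have hzs' : Valued.v (((ϖ ^ k : (v.adicCompletion K)ˣ) : v.adicCompletion K) * zs) ≤ exp r := by
    rw [map_mul]
    calc _ ≤ 1 * exp r := mul_le_mul' hϖk.le hzs_v
      _ = exp r := one_mul _
  have hz₁ : (((ϖ ^ m)⁻¹ : (v.adicCompletion K)ˣ) : v.adicCompletion K) * zs =
      (((ϖ ^ m')⁻¹ : (v.adicCompletion K)ˣ) : v.adicCompletion K) * ((((ϖ ^ k : (v.adicCompletion K)ˣ) : v.adicCompletion K)) * zs) := by
    have hu' : ((ϖ ^ m)⁻¹ : (v.adicCompletion K)ˣ) = (ϖ ^ m')⁻¹ * ϖ ^ k := by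
      rw [hk, ← _root_.zpow_neg, ← _root_.zpow_neg, ← _root_.zpow_add]; congr 1; ring
    rw [hu', Units.val_mul, mul_assoc]
  have h1 := rep_upper_conjProjector_conj hc hψ (ϖ ^ m) hzs_v x
  have h2 := rep_upper_conjProjector_conj hc hψ (ϖ ^ m') hzs' x
  rw [← hz₁] at h2
  refine inner_eq_zero_of_rep_smul_ne (U := fun y => πᵥ (𝐧ᵥ ((((ϖ ^ m)⁻¹ : (v.adicCompletion K)ˣ) : v.adicCompletion K) * zs)) y)
    (hT.inner_rep_rep _) h1 h2 (by rw [RCLike.norm_conj, Circle.norm_coe]) ?_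
  intro heq
  apply hx₀ψ
  have hsub : zs - ((ϖ ^ k : (v.adicCompletion K)ˣ) : v.adicCompletion K) * zs = x₀ := by
    rw [hzs, show ∀ a b : v.adicCompletion K, a - b * a = a * (1 - b) from fun a b => by ring, mul_assoc, inv_mul_cancel₀ hu0, mul_one]
  have heq' := (starRingEnd ℂ).injective heq
  have hc' : ((adeleAddChar K).adicComponent v) zs = ((adeleAddChar K).adicComponent v) (((ϖ ^ k : (v.adicCompletion K)ˣ) : v.adicCompletion K) * zs) :=
    Subtype.ext heq'
  have := AddChar.map_sub_eq_div ((adeleAddChar K).adicComponent v) zs (((ϖ ^ k : (v.adicCompletion K)ˣ) : v.adicCompletion K) * zs)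
  rw [hsub, hc', div_self'] at this
  exact this

include hψ in
/-- **Bessel's inequality over the shells for the conjugate projector**:
`∑_{m ∈ s} ‖Ē (π(a(ϖ^m)) x)‖² ≤ ‖x‖²`. [cite: JacquetShalikaAJM1981, §5] -/
theorem sum_norm_sq_twistedAverage_torus_le_conj {ϖ : (v.adicCompletion K)ˣ} (hϖ : Valued.v (ϖ : v.adicCompletion K) = exp (-1 : ℤ))
    {x₀ : v.adicCompletion K} (hx₀ : Valued.v x₀ ≤ exp r) (hx₀ψ : (adeleAddChar K).adicComponent v x₀ ≠ 1)
    (x : (AdelicGroupData.gl 2 K).L2 μ) (s : Finset ℤ) :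
    ∑ m ∈ s, ‖twistedAverage (shellSubgroup (F := v.adicCompletion K) r c hc) (isCompact_shellSubgroup K v hc) πᵥ χ̄ᵥ
        (πᵥ (𝐚ᵥ (ϖ ^ m)) x)‖ ^ 2 ≤ ‖x‖ ^ 2 := by
  haveI := secondCountableTopology_gl_local K v
  have hT := isTwistData_shell_conj K v μ hc hψ
  have hnorm : ∀ m : ℤ, ‖twistedAverage (shellSubgroup (F := v.adicCompletion K) r c hc) (isCompact_shellSubgroup K v hc) πᵥ χ̄ᵥ
      (πᵥ (𝐚ᵥ (ϖ ^ m)) x)‖ = ‖Ēₐ (𝐚ᵥ (ϖ ^ m)) x‖ := fun m => (hT.norm_rep_inv_apply _ _).symm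
  simp_rw [hnorm]
  refine sum_norm_sq_le_of_pairwise_inner_eq_zero s (fun m y => Ēₐ (𝐚ᵥ (ϖ ^ m)) y) x (fun m _ => ?_) (fun m _ m' _ hne => ?_)
  · show ‖Ēₐ (𝐚ᵥ (ϖ ^ m)) x‖ ^ 2 = RCLike.re ⟪Ēₐ (𝐚ᵥ (ϖ ^ m)) x, x⟫_ℂ
    rw [hT.norm_rep_inv_apply, hT.norm_sq_twistedAverage, hT.inner_rep_left, inv_inv]
  · exact inner_conjProjector_conj_eq_zero hc hψ hϖ hx₀ hx₀ψ x hne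

end Place

/-! ### The conjugate identity on smoothed vectors and the norm bounds -/

namespace ShellDatum

variable {K : Type} [Field K] [NumberField K] {v : HeightOneSpectrum (𝓞 K)} (D : ShellDatum K v)
variable [MeasurableSpace (GL (Fin 2) (v.adicCompletion K))] [BorelSpace (GL (Fin 2) (v.adicCompletion K))]
variable {μ : Measure (AdelicGroupData.gl 2 K).automorphicQuotient} [(AdelicGroupData.gl 2 K).IsAutomorphicMeasure μ]

attribute [local instance] adelicBorel borelSpace_adelic locallyCompactSpace_adelic secondCountableTopology_gl_adelic

variable (W : ContRepresentation.ClosedSubrep ((AdelicGroupData.gl 2 K).rightRegular μ))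

/-- **The conjugate identity**: `S_{Re(e_J⋆θ)} f - i S_{Im(e_J⋆θ)} f = Ē (S_θ f)`, `Ē` the twisted
average for `χ̄_v`. [cite: Bump1997, §4.4] -/
theorem coe_smoothedVector_shellRe_sub_shellIm {θ : (AdelicGroupData.gl 2 K).Adelic → ℝ} (hθ : IsTestFunctionGL 2 K θ)
    (hθK : D.IsLeftKvInvariant θ) (f : W.toSubmodule) :
    (smoothedVector W (D.shellRe θ) f : (AdelicGroupData.gl 2 K).L2 μ) - Complex.I • (smoothedVector W (D.shellIm θ) f : (AdelicGroupData.gl 2 K).L2 μ) =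
      twistedAverage D.J D.isCompact_J (localRightRegular K v μ) (fun j => conj (shellChar K v j)) (smoothedVector W θ f : (AdelicGroupData.gl 2 K).L2 μ) := by
  set w : (AdelicGroupData.gl 2 K).L2 μ := (smoothedVector W θ f : (AdelicGroupData.gl 2 K).L2 μ) with hw
  have hL : (smoothedVector W (D.shellRe θ) f : (AdelicGroupData.gl 2 K).L2 μ) - Complex.I • (smoothedVector W (D.shellIm θ) f : (AdelicGroupData.gl 2 K).L2 μ) =
      ∑ q, conj (D.coef q) • localRightRegular K v μ (D.rep q) w := by
    rw [shellRe_eq_sum, shellIm_eq_sum, D.coe_smoothedVector_sum_smul_leftTranslate W hθ, D.coe_smoothedVector_sum_smul_leftTranslate W hθ,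
      Finset.smul_sum, ← Finset.sum_sub_distrib]
    refine Finset.sum_congr rfl fun q _ => ?_
    rw [smul_smul, ← sub_smul]
    congr 1
    apply Complex.ext <;> simp
  have hT := isTwistData_shell_conj K v μ D.hc D.hψ
  have hF : ∀ j : ↥D.J, ∀ k ∈ D.KJ, conj (conj (shellChar K v ((j * k : ↥D.J) : GL (Fin 2) (v.adicCompletion K)))) •
      localRightRegular K v μ ((j * k : ↥D.J) : GL (Fin 2) (v.adicCompletion K)) w =
      conj (conj (shellChar K v (j : GL (Fin 2) (v.adicCompletion K)))) • localRightRegular K v μ (j : GL (Fin 2) (v.adicCompletion K)) w := by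
    intro j k hk
    have hk' : (k : GL (Fin 2) (v.adicCompletion K)) ∈ D.Kv := D.mem_KJ_iff.1 hk
    rw [Subgroup.coe_mul, shellChar_mul D.hψ j.2 (D.Kv_le_J hk'), D.shellChar_eq_one_of_mem_Kv hk', mul_one,
      hT.rep_mul_apply, hw, D.localRightRegular_smoothedVector_of_mem_Kv' W hθ hθK f hk']
  have hsum := integral_eq_sum_quotient_of_mul_invariant (subgroupHaar D.J D.isCompact_J) D.KJ D.isOpen_KJ
    (hT.integrable_integrand (hJ := D.isCompact_J) w) hF
  rw [hL, twistedAverage_def]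
  refine Eq.trans ?_ hsum.symm
  refine Finset.sum_congr rfl fun q _ => ?_
  simp only [Complex.conj_conj] at hsum ⊢
  rw [coef, mass, rep, map_mul, Complex.conj_conj, Complex.conj_ofReal, mul_smul]
  exact (RCLike.real_smul_eq_coe_smul (K := ℂ) _ _).symm

/-- **Norm bounds**: `‖S_{Re}‖² ≤ (‖E w‖² + ‖Ē w‖²)/2` and the same for `S_{Im}`, `w = S_θ f`. [folklore] -/
theorem norm_sq_smoothedVector_shellRe_le_and_shellIm_le {θ : (AdelicGroupData.gl 2 K).Adelic → ℝ} (hθ : IsTestFunctionGL 2 K θ)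
    (hθK : D.IsLeftKvInvariant θ) (f : W.toSubmodule) :
    ‖(smoothedVector W (D.shellRe θ) f : (AdelicGroupData.gl 2 K).L2 μ)‖ ^ 2 ≤
        (‖twistedAverage D.J D.isCompact_J (localRightRegular K v μ) (shellChar K v) (smoothedVector W θ f : (AdelicGroupData.gl 2 K).L2 μ)‖ ^ 2 +
          ‖twistedAverage D.J D.isCompact_J (localRightRegular K v μ) (fun j => conj (shellChar K v j)) (smoothedVector W θ f : (AdelicGroupData.gl 2 K).L2 μ)‖ ^ 2) / 2 ∧
      ‖(smoothedVector W (D.shellIm θ) f : (AdelicGroupData.gl 2 K).L2 μ)‖ ^ 2 ≤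
        (‖twistedAverage D.J D.isCompact_J (localRightRegular K v μ) (shellChar K v) (smoothedVector W θ f : (AdelicGroupData.gl 2 K).L2 μ)‖ ^ 2 +
          ‖twistedAverage D.J D.isCompact_J (localRightRegular K v μ) (fun j => conj (shellChar K v j)) (smoothedVector W θ f : (AdelicGroupData.gl 2 K).L2 μ)‖ ^ 2) / 2 := by
  set A := (smoothedVector W (D.shellRe θ) f : (AdelicGroupData.gl 2 K).L2 μ) with hA
  set B := (smoothedVector W (D.shellIm θ) f : (AdelicGroupData.gl 2 K).L2 μ) with hB
  set E₁ := twistedAverage D.J D.isCompact_J (localRightRegular K v μ) (shellChar K v) (smoothedVector W θ f : (AdelicGroupData.gl 2 K).L2 μ) with hE₁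
  set E₂ := twistedAverage D.J D.isCompact_J (localRightRegular K v μ) (fun j => conj (shellChar K v j)) (smoothedVector W θ f : (AdelicGroupData.gl 2 K).L2 μ) with hE₂
  have h1 : A + Complex.I • B = E₁ := D.coe_smoothedVector_shellRe_add_shellIm W hθ hθK f
  have h2 : A - Complex.I • B = E₂ := D.coe_smoothedVector_shellRe_sub_shellIm W hθ hθK f
  have hA2 : (2 : ℂ) • A = E₁ + E₂ := by rw [← h1, ← h2, two_smul]; abel
  have hB2 : (2 * Complex.I : ℂ) • B = E₁ - E₂ := by
    rw [← h1, ← h2, mul_smul, two_smul]; abel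
  have hnA : 2 * ‖A‖ ≤ ‖E₁‖ + ‖E₂‖ := by
    have := norm_add_le E₁ E₂
    rw [← hA2, norm_smul] at this
    simpa using this
  have hnB : 2 * ‖B‖ ≤ ‖E₁‖ + ‖E₂‖ := by
    have := norm_sub_le E₁ E₂
    rw [← hB2, norm_smul, norm_mul, Complex.norm_I, mul_one] at this
    simpa using this
  constructor
  · nlinarith [sq_nonneg (‖E₁‖ - ‖E₂‖), norm_nonneg A, norm_nonneg E₁, norm_nonneg E₂]
  · nlinarith [sq_nonneg (‖E₁‖ - ‖E₂‖), norm_nonneg B, norm_nonneg E₁, norm_nonneg E₂]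

end ShellDatum

end Literature.NumberTheory.Automorphic
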